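import Literature.AlgebraicGeometry.Frobenioids.GeometricDivisorPrimes
import Literature.AlgebraicGeometry.Frobenioids.ArithmeticFrobenioidNonDilating
import HarnessLib

/-!
# Frobenioids I, Theorem 6.2 (iii): two data-level steps of the printed proof — zero/pole decomposition
# of divisors of rational functions (strict rationality) and "`λ = 1`" (Frobenius-compactness core) — PROOF

Mochizuki, *The geometry of Frobenioids I: the general theory*, Kyushu J. Math. **62** (2008) 293–400,
proof of Theorem 6.2 (iii), kurims text p. 112: l. 4–8 "suppose that for every finite extension `L ⊆ K̃` of
`K`, and every `D ∈ D_L`, it holds that `D` lies in the support of the image in `Φ(L)^gp` of an element of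
`B(L)`. Then it follows formally [cf. Definition 4.5, (ii)] that `C` is of [strictly] rational type"; l. 8–15
"every object of `(C^un-tr)^birat` is Frobenius-compact. Indeed, if `α` is a `K`-linear automorphism of a finite
extension `L ⊆ K̃` of `K` that acts by multiplication by `λ ∈ ℚ_{>0}` on `Φ^birat(L)^pf (≠ 0)`, then since `α`
induces an automorphism of the variety `V[L]`, it follows that the order `∈ ℚ_{>0}` of the zero [or pole] of
highest order of an element `f ∈ Φ^birat(L)^pf` is preserved by `α`, hence that `λ = 1`".
[cite: MochizukiFrdI2008, Thm. 6.2 (iii) p.112]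

PROOF-ONLY (seat abc-iut-L6-t10, S3 sub-DAG holder; sub-nodes **T62iii/L07** and **T62iii/L09** of
`HOME/staging/L1/L1-t1/gen2/S3-LEMMA-LIST.md`, statements as typed by abc-iut-L1-t1 (gen 2) in
`MotivatingExamplesSub.lean` — `Thm62iii_L07_strictlyRational_data`, `Thm62iii_L09_frobCompact_data`), over
abc-iut-L1-t3's interface `GeometricDivisorData` v3 ALONE. PROVED:
* `GeometricDivisorData.exists_iterate_pull_eq_id` — pull-back along an endomorphism of `Spec L` has finite
  order (the endomorphism has);
* `GeometricDivisorData.eq_one_of_pull_eq_smul` / `frobCompact_data` — if `σ^* d = c · d` for a nonzero rational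
  divisor `d` and `c ∈ ℚ_{>0}`, then `c = 1` (here by finite order: `c^m · d = d`);
* `GeometricDivisorData.exists_zero_pole_decomposition` / `strictlyRational_data` — under the support hypothesis
  of Thm. 6.2 (iii), every prime divisor `P ∈ D_L` lies in the support of a Cartier effective `D` and outside the
  support of a Cartier effective `E` with `D − E = div(f)`, `f ∈ B(L)` (`f` or `f⁻¹` raised to the power
  `N = ∏ k_Q`, the positive and negative parts of `div` made Cartier by `qCartier` — `prod_smul_mem`).
No definitions; nothing here bears on [IUTchIII] or asserts anything about abc.
-/

noncomputable section

namespace Literature.AlgebraicGeometry.Frobenioids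

open CategoryTheory Function

namespace GeometricDivisorData

variable {K : Type} [Field K] {Kt : Type} [Field Kt] [Algebra K Kt] (Γ : GeometricDivisorData K Kt)
  (X : FinSubextCat K Kt)

/-! ### Pull-back along an endomorphism of `Spec L` has finite order -/

/-- The iterates of `σ^*` are pull-backs along iterates of the endomorphism `σ` of `Spec L`, and `σ` has finite
order (a `K`-algebra endomorphism of a finite extension), so `(σ^*)^m = id` for some `m ≥ 1`.
[cite: MochizukiFrdI2008, Thm. 6.2 (iii) p.112] -/
theorem exists_iterate_pull_eq_id (σ : X ⟶ X) {R : Type*} [Semiring R] :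
    ∃ m : ℕ, 0 < m ∧ (Γ.pull σ (R := R))^[m] = id := by
  obtain ⟨m, hm, hiter⟩ := EffArithDivisor.exists_iterate_eq_id σ.toAlgHom
  have hpow : ∀ j : ℕ, ∃ ρ : X ⟶ X, (Γ.pull σ (R := R))^[j] = Γ.pull ρ (R := R) ∧
      (ρ.toAlgHom : X.L → X.L) = (σ.toAlgHom : X.L → X.L)^[j] := by
    intro j
    induction j with
    | zero => exact ⟨𝟙 X, funext fun E => (Γ.pull_id X E).symm, rfl⟩
    | succ j ih =>
      obtain ⟨ρ, hρ, hρ'⟩ := ih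
      refine ⟨ρ ≫ σ, funext fun E => ?_, ?_⟩
      · rw [iterate_succ_apply, hρ, pull_comp]
      · rw [iterate_succ, ← hρ']
        rfl
  obtain ⟨ρ, hρ, hρ'⟩ := hpow m
  have hρ1 : ρ = 𝟙 X := FinSubextCat.hom_ext (AlgHom.ext fun x => by
    have := congrFun hρ' x
    rw [hiter] at this
    exact this)
  refine ⟨m, hm, ?_⟩
  rw [hρ, hρ1]
  funext E
  exact Γ.pull_id X E

/-! ### T62iii/L09: `σ^* d = c · d`, `d ≠ 0`, `c > 0` forces `c = 1` -/

/-- **T62iii/L09 — the data-level core of "every object of `(C^un-tr)^birat` is Frobenius-compact"** (FrdI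
p. 112 l. 8–15, "`λ = 1`") — PROVED for every endomorphism `σ` of `Spec L` in `D`: if `σ^* d = c · d` for a
nonzero `d ∈ ℚ[D_L]` and `c ∈ ℚ_{>0}`, then `c = 1` (`(σ^*)^m = id` gives `c^m · d = d`).
[cite: MochizukiFrdI2008, Thm. 6.2 (iii) p.112] -/
theorem eq_one_of_pull_eq_smul (σ : X ⟶ X) (d : Γ.primeDiv X →₀ ℚ) (c : ℚ) (hd : d ≠ 0) (hc : 0 < c)
    (h : Γ.pull σ d = c • d) : c = 1 := by
  obtain ⟨m, hm, hiter⟩ := Γ.exists_iterate_pull_eq_id X σ (R := ℚ)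
  have hk : ∀ k : ℕ, (Γ.pull σ (R := ℚ))^[k] d = c ^ k • d := by
    intro k
    induction k with
    | zero => rw [iterate_zero, id_eq, pow_zero, one_smul]
    | succ k ih => rw [iterate_succ_apply', ih, map_rat_smul, h, smul_smul, ← pow_succ]
  have hm' : c ^ m • d = d := by rw [← hk m, hiter, id_eq]
  have hcm : c ^ m = 1 := by
    by_contra hne
    apply hd
    have h1 : (c ^ m - 1) • d = 0 := by rw [sub_smul, one_smul, hm', sub_self]
    rcases smul_eq_zero.mp h1 with h2 | h2
    · exact absurd (sub_eq_zero.mp h2) hne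
    · exact h2
  exact (pow_eq_one_iff_of_nonneg hc.le hm.ne').mp hcm

/-- The typed statement T62iii/L09 verbatim (automorphisms `σ : Spec L ≅ Spec L`; the hypothesis is used only
through `σ.hom`). [cite: MochizukiFrdI2008, Thm. 6.2 (iii) p.112] -/
theorem frobCompact_data :
    ∀ (X : FinSubextCat K Kt) (σ : X ≅ X) (d : Γ.primeDiv X →₀ ℚ) (c : ℚ), d ≠ 0 → 0 < c →
      DivisorCoeff.pull (Γ.over σ.hom) (Γ.ram σ.hom) (Γ.over_finite σ.hom) d = c • d → c = 1 :=
  fun X σ d c hd hc h => Γ.eq_one_of_pull_eq_smul X σ.hom d c hd hc h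

/-! ### T62iii/L07: zero/pole decomposition of `div(f^N)` into Cartier effective divisors -/

/-- **T62iii/L07 — the data-level content of "it follows formally [cf. Definition 4.5, (ii)] that `C` is of
[strictly] rational type"** under the support hypothesis of Thm. 6.2 (iii) (FrdI p. 112 l. 4–8) — PROVED from
the interface alone: if `P` lies in the support of `div(f)`, then (replacing `f` by `f⁻¹` if `P` is a pole, and
raising to the power `N = ∏_{Q ∈ supp div(f)} k_Q` so that the positive and negative parts become Cartier,
`qCartier`) `div(f^{±N}) = D − E` with `D, E ∈ Φ(L)`, `P ∈ supp D`, `P ∉ supp E`.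
[cite: MochizukiFrdI2008, Thm. 6.2 (iii) p.112] -/
theorem exists_zero_pole_decomposition (P : Γ.primeDiv X) (f : Γ.B X)
    (hf : (Multiplicative.toAdd (Γ.div X f)) P ≠ 0) :
    ∃ (g : Γ.B X) (D E : Γ.primeDiv X →₀ ℕ), D ∈ Γ.Phi X ∧ E ∈ Γ.Phi X ∧
      Multiplicative.toAdd (Γ.div X g) = DivisorCoeff.toInt D - DivisorCoeff.toInt E ∧
        P ∈ D.support ∧ P ∉ E.support := by
  classical
  -- WLOG `P` is a zero of `f`: otherwise pass to `f⁻¹`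
  suffices key : ∀ (f : Γ.B X), 0 < (Multiplicative.toAdd (Γ.div X f)) P →
      ∃ (g : Γ.B X) (D E : Γ.primeDiv X →₀ ℕ), D ∈ Γ.Phi X ∧ E ∈ Γ.Phi X ∧
        Multiplicative.toAdd (Γ.div X g) = DivisorCoeff.toInt D - DivisorCoeff.toInt E ∧
          P ∈ D.support ∧ P ∉ E.support by
    rcases lt_or_gt_of_ne hf with hlt | hgt
    · refine key f⁻¹ ?_
      rw [map_inv, toAdd_inv, Finsupp.neg_apply]
      exact neg_pos.mpr hlt
    · exact key f hgt
  intro f hfP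
  choose k hk0 hk using Γ.qCartier X
  set v : Γ.primeDiv X →₀ ℤ := Multiplicative.toAdd (Γ.div X f) with hv
  -- positive and negative parts of `v`
  let vp : Γ.primeDiv X →₀ ℕ := v.mapRange Int.toNat (by simp)
  let vn : Γ.primeDiv X →₀ ℕ := (-v).mapRange Int.toNat (by simp)
  have hvpn : DivisorCoeff.toInt vp - DivisorCoeff.toInt vn = v := by
    ext Q
    simp only [Finsupp.coe_sub, Pi.sub_apply, DivisorCoeff.toInt_apply, vp, vn, Finsupp.mapRange_apply,
      Finsupp.neg_apply]
    exact Int.toNat_sub_toNat_neg (v Q)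
  -- the Cartier multiple
  set T := v.support with hT
  set N := ∏ t ∈ T, k t with hN
  have hN0 : 0 < N := Finset.prod_pos fun t _ => hk0 t
  have hvp_supp : vp.support ⊆ T := by
    intro Q hQ
    rw [Finsupp.mem_support_iff] at hQ ⊢
    intro h0
    apply hQ
    simp [vp, h0]
  have hvn_supp : vn.support ⊆ T := by
    intro Q hQ
    rw [Finsupp.mem_support_iff] at hQ ⊢
    intro h0
    apply hQ
    simp [vn, h0]
  refine ⟨f ^ N, N • vp, N • vn, Γ.prod_smul_mem X T k hk vp hvp_supp, Γ.prod_smul_mem X T k hk vn hvn_supp,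
    ?_, ?_, ?_⟩
  · rw [map_pow, toAdd_pow, ← hv, ← hvpn, map_nsmul, map_nsmul, smul_sub]
  · rw [Finsupp.support_smul_eq hN0.ne']
    rw [Finsupp.mem_support_iff]
    simp only [vp, Finsupp.mapRange_apply, ne_eq, Int.toNat_eq_zero, not_le]
    exact hfP
  · rw [Finsupp.support_smul_eq hN0.ne', Finsupp.mem_support_iff, not_not]
    simp only [vn, Finsupp.mapRange_apply, Finsupp.neg_apply, Int.toNat_eq_zero]
    exact neg_nonpos.mpr hfP.le

/-- The typed statement T62iii/L07 verbatim. [cite: MochizukiFrdI2008, Thm. 6.2 (iii) p.112] -/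
theorem strictlyRational_data :
    (∀ (X : FinSubextCat K Kt) (P : Γ.primeDiv X), ∃ f : Γ.B X, (Multiplicative.toAdd (Γ.div X f)) P ≠ 0) →
      ∀ (X : FinSubextCat K Kt) (P : Γ.primeDiv X), ∃ (f : Γ.B X) (D E : Γ.primeDiv X →₀ ℕ),
        D ∈ Γ.Phi X ∧ E ∈ Γ.Phi X ∧
          Multiplicative.toAdd (Γ.div X f) = DivisorCoeff.toInt D - DivisorCoeff.toInt E ∧
            P ∈ D.support ∧ P ∉ E.support := by
  intro h X P
  obtain ⟨f, hf⟩ := h X P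
  exact Γ.exists_zero_pole_decomposition X P f hf

end GeometricDivisorData

end Literature.AlgebraicGeometry.Frobenioids

end
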